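import Literature.MathematicalPhysics.KineticTheory.KickMatchedHardSphereGas
import Literature.MathematicalPhysics.KineticTheory.DiceRejectionSampling
import Literature.Analysis.FluidPDE.LambertCosineLaw
import HarnessLib

/-!
# The law of the resampled normal of the kick-matched hard-sphere gas `Z*`

Topic `Literature/MathematicalPhysics/KineticTheory` (supports crux `stmt-AtomisticToContinuum-13914`,
`InformationPercolationEngine.PercolationClosesChaos`, line `stein-lindeberg-kick-swap`: node `NormalLaw` of the
Gibbs-stationarity statement `KickMatchedStationaryCore` (stub W2) and the "law of `kmNormal`" input of the swap identity
(stub S3a)). Grouping namespace `Literature.MathematicalPhysics.KineticTheory.KickMatchedHardSphereGas`.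

The rejection sampler `kmNormal σ N i j y ·` of `Z*`, driven by ONE die `(discLaw)^{⊗ℕ}` (i.i.d. uniform points of the
unit disc lifted to the hemisphere about `a = (w − v)/|w − v|` by `Lambert.lift a`, the first ADMISSIBLE candidate
taken), has law = the flux (cosine) law `fluxLaw vᵢ vⱼ` of the pair RESTRICTED to the admissible set and normalised,
whenever the pair velocities differ and the admissible set has positive flux measure (`map_dice_kmNormal`).
Ingredients: the hat-box lemma `map_lift_volume_ball` (`LambertCosineLaw`: the lifted uniform disc law is the cosine
law, here `map_lift_discLaw`), rejection sampling `KernelGas.map_dice_firstHit` (`DiceRejectionSampling`: the first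
i.i.d. proposal in `A` has law `μ(· | A)`), and `fluxLaw v w = |w − v| • (cosine law about a)` (`fluxLaw_eq_smul_cosLaw`);
all constants cancel (the a.e.-measurability of the `Nat.find` selector is read off its law, no measurability lemma for
`dite`/`Nat.find` is needed).

## References

* F. Comets, S. Popov, G. M. Schütz, M. Vachkovskaia, *Billiards in a general domain with random reflections*,
  ARMA 191 (2008), §2.2 (the cosine reflection law `γ(du) ∝ ⟪e, u⟫ du` and its sampling). [CometsEtAl2008]
* L. Devroye, *Non-Uniform Random Variate Generation*, Springer (1986), §II.3 (the rejection method returns the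
  conditional law). [Devroye1986]
-/

noncomputable section

open scoped BigOperators ENNReal Topology RealInnerProductSpace
open MeasureTheory Set Filter
open Literature.Analysis.FluidPDE

namespace Literature.MathematicalPhysics.KineticTheory.KickMatchedHardSphereGas


variable {σ : ℝ} {N : ℕ}

/-- The cosine (Lambert / Knudsen) law of the hemisphere about the unit vector `a` on the unit sphere of `ℝ³`:
density `⟪a, ν⟫₊` against the surface measure. [folklore] -/
def cosLaw (a : V3) : Measure (Metric.sphere (0 : V3) 1) :=
  volume.toSphere.withDensity fun ν => ENNReal.ofReal ⟪a, (ν : V3)⟫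

/-- **`discLaw` lifted by `Lambert.lift a` is the normalised cosine law** (`‖a‖ = 1`): `discLaw ∘ (lift a)⁻¹ =
π⁻¹ · ι_* cosLaw a` (hat-box lemma `map_lift_volume_ball`; the unit circle is Lebesgue-null and `|B̄(0,1)| = π`).
[folklore] -/
-- adapted from the W2/S3a stub workers' `Km.map_lift_discLaw` / `Km.map_dice_kmNormal` (work files of line
-- stein-lindeberg-kick-swap, not landed)
theorem map_lift_discLaw {a : V3} (ha : ‖a‖ = 1) :
    discLaw.map (Lambert.lift a) =
      (ENNReal.ofReal Real.pi)⁻¹ • (cosLaw a).map ((↑) : Metric.sphere (0 : V3) 1 → V3) := by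
  have hcb : (volume : Measure (EuclideanSpace ℝ (Fin 2))).restrict (Metric.closedBall 0 1) =
      volume.restrict (Metric.ball 0 1) := by
    refine Measure.restrict_congr_set (ae_eq_set.2 ⟨?_, ?_⟩)
    · rw [Metric.closedBall_sdiff_ball, Measure.addHaar_sphere]
    · rw [Set.sdiff_eq_empty.2 Metric.ball_subset_closedBall, measure_empty]
  have hvol : (volume : Measure (EuclideanSpace ℝ (Fin 2))) (Metric.closedBall 0 1) = ENNReal.ofReal Real.pi := by
    rw [EuclideanSpace.volume_closedBall_fin_two, ENNReal.ofReal_one, one_pow, one_mul]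
  rw [discLaw, Measure.map_smul, hvol, hcb, map_lift_volume_ball ha]
  rfl

/-- **The flux law is `|w − v|` times the cosine law about `a = (w − v)/|w − v|`** (`v ≠ w`):
`((w − v)·ω)₊ = |w − v| ⟪a, ω⟫₊`. [folklore] -/
theorem fluxLaw_eq_smul_cosLaw {v w : V3} (hvw : w ≠ v) :
    fluxLaw v w = ENNReal.ofReal ‖w - v‖ • cosLaw (‖w - v‖⁻¹ • (w - v)) := by
  have hn : 0 < ‖w - v‖ := norm_pos_iff.2 (sub_ne_zero.2 hvw)
  have hmeas : Measurable fun ν : Metric.sphere (0 : V3) 1 => ENNReal.ofReal ⟪‖w - v‖⁻¹ • (w - v), (ν : V3)⟫ :=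
    (continuous_const.inner continuous_subtype_val).measurable.ennreal_ofReal
  have hfun : (fun ω : Metric.sphere (0 : V3) 1 => ENNReal.ofReal (hardSphereKernel (w, v) ω)) =
      ENNReal.ofReal ‖w - v‖ • fun ν : Metric.sphere (0 : V3) 1 => ENNReal.ofReal ⟪‖w - v‖⁻¹ • (w - v), (ν : V3)⟫ := by
    funext ω
    simp only [Pi.smul_apply, smul_eq_mul, hardSphereKernel]
    rw [← ENNReal.ofReal_mul hn.le, real_inner_smul_left, mul_inv_cancel_left₀ hn.ne']
    rcases le_total ⟪w - v, (ω : V3)⟫ 0 with h | h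
    · rw [max_eq_right h, ENNReal.ofReal_zero, ENNReal.ofReal_eq_zero.2 h]
    · rw [max_eq_left h]
  unfold fluxLaw cosLaw
  rw [hfun, withDensity_smul _ hmeas]
  rfl

/-- The admissible set of normals (as a subset of `V3`) is measurable. [folklore] -/
theorem measurableSet_isAdmissible_right (i j : Fin (N + 1)) (y : Cfg N) :
    MeasurableSet {ω : V3 | IsAdmissible σ N i j ω y} := by
  have hG : geo.IsMeasurable := Torus.isMeasurable_geometry
  have hu : Measurable fun ω : V3 => (geo.translate (y i).1 (-(hsDiameter σ N • ω)), (y j).2) :=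
    (hG.measurable_translate.comp (measurable_const.prodMk ((measurable_id.const_smul (hsDiameter σ N)).neg))).prodMk
      measurable_const
  have hk : Measurable fun ω : V3 => kickAt σ N i j ω y := by
    unfold kickAt
    exact (hG.measurable_collidePair i j).comp (measurable_update'.comp (measurable_const.prodMk hu))
  have h1 : MeasurableSet {ω : V3 | ‖ω‖ = 1} := measurableSet_eq_fun measurable_norm measurable_const
  have h2 : MeasurableSet {ω : V3 | 0 < ⟪(y j).2 - (y i).2, ω⟫} :=
    measurableSet_lt measurable_const (measurable_const.inner measurable_id)
  exact h1.inter (h2.inter ((measurableSet_hardSphereDomain geo Torus.measurable_geometry_sepVec (N + 1)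
    (hsDiameter σ N)).preimage hk))

open Classical in
/-- **The law of the resampled normal** `kmNormal σ N i j y ·` under ONE die `(discLaw)^{⊗ℕ}`: whenever the pair
velocities differ and the admissible set `A(y)` has positive flux measure, it is the flux (cosine) law of the pair
`fluxLaw vᵢ vⱼ` RESTRICTED to `A(y)` and normalised (pushed to `V3`) — rejection sampling (`KernelGas.map_dice_firstHit`)
of candidates whose law is `π⁻¹ · cosine law` (`map_lift_discLaw`), and `fluxLaw = |w − v| · cosine law`
(`fluxLaw_eq_smul_cosLaw`): all constants cancel. This is the node `NormalLaw` of the Gibbs-stationarity statement `KickMatchedStationaryCore` of `Z*` and the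
"law of `kmNormal`" input of the swap identity of the line. [cite: CometsEtAl2008, §2.2] -/
theorem map_dice_kmNormal (i j : Fin (N + 1)) (y : Cfg N) (hvw : (y j).2 ≠ (y i).2)
    (hA : fluxLaw (y i).2 (y j).2 {ω | IsAdmissible σ N i j (ω : V3) y} ≠ 0) :
    (KernelGas.dice discLaw).map (kmNormal σ N i j y) =
      ((fluxLaw (y i).2 (y j).2 {ω | IsAdmissible σ N i j (ω : V3) y})⁻¹ •
        (fluxLaw (y i).2 (y j).2).restrict {ω | IsAdmissible σ N i j (ω : V3) y}).map (↑) := by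
  -- notation
  set v : V3 := (y i).2 with hv
  set w : V3 := (y j).2 with hw
  set a : V3 := ‖w - v‖⁻¹ • (w - v) with ha_def
  have hn : 0 < ‖w - v‖ := norm_pos_iff.2 (sub_ne_zero.2 hvw)
  have ha : ‖a‖ = 1 := by
    rw [ha_def, norm_smul, norm_inv, norm_norm, inv_mul_cancel₀ hn.ne']
  set A' : Set V3 := {ω | IsAdmissible σ N i j ω y} with hA'_def
  have hA'm : MeasurableSet A' := measurableSet_isAdmissible_right i j y
  set A : Set (Metric.sphere (0 : V3) 1) := {ω | IsAdmissible σ N i j (ω : V3) y} with hA_def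
  have hAA' : A = ((↑) : Metric.sphere (0 : V3) 1 → V3) ⁻¹' A' := rfl
  have hAm : MeasurableSet A := by rw [hAA']; exact measurable_subtype_coe hA'm
  set P : Set (EuclideanSpace ℝ (Fin 2)) := Lambert.lift a ⁻¹' A' with hP_def
  have hPm : MeasurableSet P := Lambert.measurable_lift a hA'm
  set T : Set (EuclideanSpace ℝ (Fin 2)) := {q | ‖q‖ ≤ 1 ∧ IsAdmissible σ N i j (Lambert.lift a q) y} with hT_def
  have hTeq : T = P ∩ Metric.closedBall 0 1 := by
    ext q
    simp only [hT_def, hP_def, hA'_def, mem_setOf_eq, mem_inter_iff, mem_preimage, Metric.mem_closedBall, dist_zero_right]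
    exact and_comm
  have hTm : MeasurableSet T := by rw [hTeq]; exact hPm.inter Metric.isClosed_closedBall.measurableSet
  -- `discLaw` is supported on the closed disc, so `T` and `P` agree `discLaw`-a.e.
  have hrestr : discLaw.restrict T = discLaw.restrict P := by
    rw [hTeq, ← Measure.restrict_restrict hPm]
    congr 1
    rw [discLaw, Measure.restrict_smul, Measure.restrict_restrict Metric.isClosed_closedBall.measurableSet, inter_self]
  have hTP : discLaw T = discLaw P := by
    rw [← Measure.restrict_apply_univ T, hrestr, Measure.restrict_apply_univ]
  -- the scalars
  set πe : ℝ≥0∞ := ENNReal.ofReal Real.pi with hπe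
  have hπ0 : πe ≠ 0 := (ENNReal.ofReal_pos.2 Real.pi_pos).ne'
  have hπt : πe ≠ ∞ := ENNReal.ofReal_ne_top
  set L : ℝ≥0∞ := ENNReal.ofReal ‖w - v‖ with hL
  have hL0 : L ≠ 0 := (ENNReal.ofReal_pos.2 hn).ne'
  have hLt : L ≠ ∞ := ENNReal.ofReal_ne_top
  have hflux : fluxLaw v w = L • cosLaw a := fluxLaw_eq_smul_cosLaw hvw
  have hdiscP : discLaw P = πe⁻¹ * cosLaw a A := by
    rw [hP_def, ← Measure.map_apply (Lambert.measurable_lift a) hA'm, map_lift_discLaw ha, Measure.smul_apply,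
      Measure.map_apply measurable_subtype_coe hA'm, smul_eq_mul, ← hAA']
  have hcA0 : cosLaw a A ≠ 0 := by
    intro h0
    apply hA
    show fluxLaw v w A = 0
    rw [hflux, Measure.smul_apply, h0, smul_zero]
  have hT0 : discLaw T ≠ 0 := by
    rw [hTP, hdiscP]
    exact mul_ne_zero (ENNReal.inv_ne_zero.2 hπt) hcA0
  -- the selector of the rejection sampler and its law
  set sel : Die → EuclideanSpace ℝ (Fin 2) := fun d => if h : ∃ n, d n ∈ T then d (Nat.find h) else 0 with hsel
  have hsel_law : (KernelGas.dice discLaw).map sel = (discLaw T)⁻¹ • discLaw.restrict T :=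
    KernelGas.map_dice_firstHit discLaw hTm hT0 0
  -- the selector is a.e.-measurable: otherwise its law would be the zero measure, not `discLaw(· | T)`
  have hsel_ae : AEMeasurable sel (KernelGas.dice discLaw) := by
    by_contra h
    have h0 := congrArg (fun m : Measure (EuclideanSpace ℝ (Fin 2)) => m Set.univ) hsel_law
    simp only [Measure.map_of_not_aemeasurable h, Measure.coe_zero, Pi.zero_apply, Measure.smul_apply,
      Measure.restrict_apply_univ, smul_eq_mul] at h0
    exact mul_ne_zero (ENNReal.inv_ne_zero.2 (measure_ne_top discLaw T)) hT0 h0.symm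
  -- `kmNormal y` is `lift a ∘ sel` off the null event of no success
  have hae : (kmNormal σ N i j y) =ᵐ[KernelGas.dice discLaw] fun d => Lambert.lift a (sel d) := by
    have hnull : KernelGas.dice discLaw {d : Die | ∀ n, d n ∉ T} = 0 :=
      KernelGas.dice_forall_notMem_eq_zero discLaw hTm hT0
    refine (ae_iff.2 (measure_mono_null (fun d hd => ?_) hnull))
    simp only [mem_setOf_eq] at hd ⊢
    intro n hn'
    apply hd
    have hex : ∃ n, d n ∈ T := ⟨n, hn'⟩
    show kmNormal σ N i j y d = Lambert.lift a (sel d)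
    rw [hsel]
    simp only [dif_pos hex]
    unfold kmNormal
    simp only [← hv, ← hw, ← ha_def]
    rw [dif_pos (show ∃ n, ‖d n‖ ≤ 1 ∧ IsAdmissible σ N i j (Lambert.lift a (d n)) y from hex)]
    congr 2
  -- assemble
  have e1 : (KernelGas.dice discLaw).map (kmNormal σ N i j y) =
      ((KernelGas.dice discLaw).map sel).map (Lambert.lift a) := by
    rw [Measure.map_congr hae, AEMeasurable.map_map_of_aemeasurable (Lambert.measurable_lift a).aemeasurable hsel_ae]
    rfl
  have e2 : ((KernelGas.dice discLaw).map sel).map (Lambert.lift a) =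
      (discLaw P)⁻¹ • (discLaw.map (Lambert.lift a)).restrict A' := by
    rw [hsel_law, Measure.map_smul, hrestr, hTP, hP_def, Measure.restrict_map (Lambert.measurable_lift a) hA'm]
  have e3 : (discLaw.map (Lambert.lift a)).restrict A' =
      πe⁻¹ • ((cosLaw a).restrict A).map ((↑) : Metric.sphere (0 : V3) 1 → V3) := by
    rw [map_lift_discLaw ha, Measure.restrict_smul, Measure.restrict_map measurable_subtype_coe hA'm, ← hAA']
  have e4 : ((fluxLaw v w A)⁻¹ • (fluxLaw v w).restrict A).map ((↑) : Metric.sphere (0 : V3) 1 → V3) =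
      ((L * cosLaw a A)⁻¹ * L) • ((cosLaw a).restrict A).map ((↑) : Metric.sphere (0 : V3) 1 → V3) := by
    rw [Measure.map_smul, hflux, Measure.smul_apply, Measure.restrict_smul, Measure.map_smul, smul_smul, smul_eq_mul]
  have lhs : (πe⁻¹ * cosLaw a A)⁻¹ * πe⁻¹ = (cosLaw a A)⁻¹ := by
    rw [ENNReal.mul_inv (Or.inl (ENNReal.inv_ne_zero.2 hπt)) (Or.inl (ENNReal.inv_ne_top.2 hπ0)), inv_inv,
      mul_comm πe, mul_assoc, ENNReal.mul_inv_cancel hπ0 hπt, mul_one]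
  have rhs : (L * cosLaw a A)⁻¹ * L = (cosLaw a A)⁻¹ := by
    rw [ENNReal.mul_inv (Or.inl hL0) (Or.inl hLt), mul_comm L⁻¹, mul_assoc, ENNReal.inv_mul_cancel hL0 hLt, mul_one]
  rw [e1, e2, e3, hdiscP, smul_smul, e4, lhs, rhs]

end Literature.MathematicalPhysics.KineticTheory.KickMatchedHardSphereGas

end
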